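import Summits.Ventures.CertifiedManyBodySolver.Observables.StiffnessThermalOddMomentHook
import Summits.Ventures.CertifiedManyBodySolver.Observables.StiffnessTLOddMomentOrbitRowTT
import Literature.MathematicalPhysics.QuantumLattice.TorusSectorGibbsMixtureSymmetry
import HarnessLib

/-!
# Reader-shape adapters for the thermal odd-moment (Krylov-3) hook (ROUTE T-B′, cell `pub/hubbard-tc`)

HONEST FRAMING: ladder R1–R4 with certified numbers; no claim on H/H₀. Cell `pub/hubbard-tc` (MO-S3 ORDER → T_c
back-end), seat `hubbard-tc-mod-2` (KT back-end; HOME/hubbard-tc-mod-2/k3thermal/FLAM-OBJECTIVE.md §5). A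
one-sided CEILING chain (thermal Gibbs words ⇒ flux stiffness ⇒ `T_KT`); not a superconductivity verdict, not a
`T_c` of any material; NO certificate and NO number lives in this file.

The hook `ObsThermalStiffnessSeqCeilingAtBeta_of_torusLimit_oddMoment_le` (`StiffnessThermalOddMomentHook.lean`)
consumes `oddMomentLimitFunctionalTT t′ U λ ω ≤ q` on every torus limit `ω` of the canonical sector Gibbs states at
`β`. A thermal producer (hubbard-thermal's EEB/KMS relaxation) symmetrises its words over the point group and may print
its certificate in either of two other shapes; both are reduced here to the hook's hypothesis, so that a certificate in
ANY of the three shapes lands as a three-line row file: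

* §1 `oddMomentLimitFunctionalTT_eq_rot_of_isD4Invariant` / `…_eq_orbitMean_of_isD4Invariant` — on a translation- and
  `D₄`-invariant state every rotated copy `Re ω_{γΛ₇}(Γ(d4Emb γ 0 Λ₇) X_λ)` (`rotOddMomentLimitFunctionalTT`, obs-p2's
  `StiffnessTLOddMomentOrbitRowTT`) equals `F_λ(ω)`, hence so does every orbit mean over a nonempty `S ⊆ D₄`; torus
  limits of the sector Gibbs mixtures ARE `D₄`-invariant (`IsTorusLimitOfMixture.isD4Invariant_of_sectorGibbs`).
* §2 `ObsThermalStiffnessSeqCeilingAtBeta_of_torusLimit_oddMoment_orbitMean_le` — ORBIT-MEAN reader shape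
  `|S|⁻¹ Σ_{γ∈S} rotOddMomentLimitFunctionalTT t′ U λ γ ω ≤ q` ⇒ the single-temperature leaf; and
  `ObsThermalStiffnessSeqCeilingAtBeta_of_torusLimit_neg_oddMomentObs_ge` — NEGATED («lower row») reader shape
  `−q ≤ Re ω_{Λ₇}(−X_λ)` (`oddMomentObsTT`) ⇒ the leaf.
* §3 `T_c` closures: `ThermalKTDictionaryAt.le_inv_of_torusLimit_oddMoment_orbitMean_le` (any `β`: `(π/4)q < 1/β ⇒
  Tc ≤ 1/β`) and the three PRE-REGISTERED row forms of the cell at `(8, ⅞, 0)`, `λ` free (of record `−3/256`):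
  `β·t = 4` ⇒ `Tc ≤ 1/4` if `q < 0.3183098` (PRIMARY), `β·t = 16/5` ⇒ `Tc ≤ 5/16` if `q < 0.3978873` (CALIBRATION,
  row-neutral), `β·t = 9/2` ⇒ `Tc ≤ 2/9` if `q < 0.2829421` (SECONDARY) — for the plain and the orbit-mean shapes.

WHAT THIS IS NOT: no thermal certificate of the word exists today (producer price: thermal_eeb L1 + RDM boxes
{pent, line4}, FLAM-OBJECTIVE.md §2); keys K1t K1b K2, NO monotonicity (K3) anywhere in this file.

References: DLS1978 §2 eqs. (22′), (27), (28); Lipparini2008 eq. (8.30); HazraVermaRanderia2019 eqs. (2)–(4);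
BratteliRobinsonI1987 §4.3.1; ScalapinoWhiteZhang1993 §II.
-/

noncomputable section

namespace Summit.Ventures.CertifiedManyBodySolver.Observables

open Filter Topology Matrix Finset
open Literature.MathematicalPhysics.QuantumLattice
open Literature.MathematicalPhysics.QuantumLattice.ThermodynamicLimit
open Literature.MathematicalPhysics.QuantumFieldTheory
open Literature.MathematicalPhysics.StatisticalMechanics
open Literature.MathematicalPhysics.StatisticalMechanics.KosterlitzThouless
open Literature.Probability.LatticeModels
open scoped ComplexConjugate ComplexOrder

/-! ## §1 The rotated copies and the orbit mean of `F_λ` on a `D₄`-invariant state -/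

section Orbit

/-- **Every rotated copy of the odd-moment word reads `F_λ` on a `D₄`-invariant state**:
`rotOddMomentLimitFunctionalTT t′ U λ γ ω = oddMomentLimitFunctionalTT t′ U λ ω` (`IsD4Invariant.expect_fermionEmbed_d4Emb`
+ `re_expect_oddMomentObsTT`). [cite: BratteliRobinsonI1987, §4.3.1] [cite: Lipparini2008, eq. (8.30)] -/
theorem rotOddMomentLimitFunctionalTT_eq_of_isD4Invariant {ω : InfVolFermionState 2} (hD : ω.IsD4Invariant)
    (tp U lam : ℝ) (γ : DihedralGroup 4) :
    rotOddMomentLimitFunctionalTT tp U lam γ ω = oddMomentLimitFunctionalTT tp U lam ω := by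
  unfold rotOddMomentLimitFunctionalTT
  rw [hD.expect_fermionEmbed_d4Emb, re_expect_oddMomentObsTT]

/-- **The orbit mean over any nonempty `S ⊆ D₄` reads `F_λ` on a `D₄`-invariant state.**
[cite: BratteliRobinsonI1987, §4.3.1] [cite: Lipparini2008, eq. (8.30)] -/
theorem orbitMean_rotOddMomentLimitFunctionalTT_eq_of_isD4Invariant {ω : InfVolFermionState 2} (hD : ω.IsD4Invariant)
    (tp U lam : ℝ) {S : Finset (DihedralGroup 4)} (hS : S.Nonempty) :
    (∑ γ ∈ S, rotOddMomentLimitFunctionalTT tp U lam γ ω) / S.card = oddMomentLimitFunctionalTT tp U lam ω := by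
  simp_rw [rotOddMomentLimitFunctionalTT_eq_of_isD4Invariant hD]
  rw [Finset.sum_const, nsmul_eq_mul, mul_div_cancel_left₀]
  exact Nat.cast_ne_zero.2 (Finset.card_pos.2 hS).ne'

/-- **On torus limits of the canonical sector Gibbs states the orbit-mean reader shape IS the hook's word**:
`|S|⁻¹ Σ_{γ∈S} rotOddMomentLimitFunctionalTT t′ U λ γ ω = oddMomentLimitFunctionalTT t′ U λ ω`
(`IsTorusLimitOfMixture.isD4Invariant_of_sectorGibbs`). [cite: BratteliRobinsonI1987, §4.3.1] -/
theorem orbitMean_rotOddMomentLimitFunctionalTT_eq_of_sectorGibbs {tp U n β : ℝ} (lam : ℝ)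
    {S : Finset (DihedralGroup 4)} (hS : S.Nonempty) {ω : InfVolFermionState 2} {Ls : ℕ → ℕ}
    (hLs : Tendsto Ls atTop atTop)
    (hω : ω.IsTorusLimitOfMixture (sectorGibbsCount n) (fun L => sectorGibbsWeightTT' β 1 tp U n L)
      (fun L => sectorGibbsVectorTT' 1 tp U n L) Ls) :
    (∑ γ ∈ S, rotOddMomentLimitFunctionalTT tp U lam γ ω) / S.card = oddMomentLimitFunctionalTT tp U lam ω :=
  orbitMean_rotOddMomentLimitFunctionalTT_eq_of_isD4Invariant (hω.isD4Invariant_of_sectorGibbs 1 tp U n β hLs) tp U lam hS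

/-- **The negated («lower row») reader shape is the hook's word with a sign**:
`Re ω_{Λ₇}(−X_λ) = −oddMomentLimitFunctionalTT t′ U λ ω`. [cite: Lipparini2008, eq. (8.30)] -/
theorem re_expect_neg_oddMomentObsTT (tp U lam : ℝ) (ω : InfVolFermionState 2) :
    (ω.expect (box 2 7) (-oddMomentObsTT tp U lam)).re = -oddMomentLimitFunctionalTT tp U lam ω := by
  rw [map_neg, Complex.neg_re, re_expect_oddMomentObsTT]

end Orbit

/-! ## §2 The leaf from the two producer reader shapes -/

section Hook

/-- **ORBIT-MEAN reader shape ⇒ the single-temperature leaf (ROUTE T-B′).** If for one real `λ` and one nonempty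
`S ⊆ D₄` every torus limit `ω` of the canonical `(rectN n L, S^z = 0)` Gibbs states of `hubbardTorusTT' L 1 t′ U` at `β`
satisfies `|S|⁻¹ Σ_{γ∈S} rotOddMomentLimitFunctionalTT t′ U λ γ ω ≤ q`, then `ObsThermalStiffnessSeqCeilingAtBeta t′ U n β q`:
the orbit mean equals `F_λ(ω)` on such `ω` (§1) and the hook applies. [cite: DLS1978, §2 eqs. (22'), (27), (28)]
[cite: BratteliRobinsonI1987, §4.3.1] -/
theorem ObsThermalStiffnessSeqCeilingAtBeta_of_torusLimit_oddMoment_orbitMean_le {tp U n β : ℝ} (hβ : 0 < β)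
    (hn0 : 0 ≤ n) (hn2 : n ≤ 2) (lam : ℝ) {S : Finset (DihedralGroup 4)} (hS : S.Nonempty) {q : ℚ}
    (hbound : ∀ (ω : InfVolFermionState 2) (Ls : ℕ → ℕ), Tendsto Ls atTop atTop →
      ω.IsTorusLimitOfMixture (sectorGibbsCount n) (fun L => sectorGibbsWeightTT' β 1 tp U n L)
        (fun L => sectorGibbsVectorTT' 1 tp U n L) Ls →
      (∑ γ ∈ S, rotOddMomentLimitFunctionalTT tp U lam γ ω) / S.card ≤ ((q : ℚ) : ℝ)) :
    ObsThermalStiffnessSeqCeilingAtBeta tp U n β q :=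
  ObsThermalStiffnessSeqCeilingAtBeta_of_torusLimit_oddMoment_le hβ hn0 hn2 lam fun ω Ls hLs hω => by
    rw [← orbitMean_rotOddMomentLimitFunctionalTT_eq_of_sectorGibbs lam hS hLs hω]
    exact hbound ω Ls hLs hω

/-- **Single rotated copy ⇒ the leaf** (the orbit-mean shape with `S = {γ}`). [cite: BratteliRobinsonI1987, §4.3.1] -/
theorem ObsThermalStiffnessSeqCeilingAtBeta_of_torusLimit_rotOddMoment_le {tp U n β : ℝ} (hβ : 0 < β)
    (hn0 : 0 ≤ n) (hn2 : n ≤ 2) (lam : ℝ) (γ : DihedralGroup 4) {q : ℚ}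
    (hbound : ∀ (ω : InfVolFermionState 2) (Ls : ℕ → ℕ), Tendsto Ls atTop atTop →
      ω.IsTorusLimitOfMixture (sectorGibbsCount n) (fun L => sectorGibbsWeightTT' β 1 tp U n L)
        (fun L => sectorGibbsVectorTT' 1 tp U n L) Ls →
      rotOddMomentLimitFunctionalTT tp U lam γ ω ≤ ((q : ℚ) : ℝ)) :
    ObsThermalStiffnessSeqCeilingAtBeta tp U n β q :=
  ObsThermalStiffnessSeqCeilingAtBeta_of_torusLimit_oddMoment_le hβ hn0 hn2 lam fun ω Ls hLs hω => by
    rw [← rotOddMomentLimitFunctionalTT_eq_of_isD4Invariant (hω.isD4Invariant_of_sectorGibbs 1 tp U n β hLs) tp U lam γ]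
    exact hbound ω Ls hLs hω

/-- **NEGATED («lower row») reader shape ⇒ the leaf (ROUTE T-B′).** If every torus limit `ω` of the canonical sector
Gibbs states at `β` satisfies `−q ≤ Re ω_{Λ₇}(−X_λ)` (`X_λ = oddMomentObsTT t′ U λ`, the word a MIN-sense producer
prints), then `ObsThermalStiffnessSeqCeilingAtBeta t′ U n β q`. [cite: DLS1978, §2 eqs. (22'), (27), (28)]
[cite: Lipparini2008, eq. (8.30)] -/
theorem ObsThermalStiffnessSeqCeilingAtBeta_of_torusLimit_neg_oddMomentObs_ge {tp U n β : ℝ} (hβ : 0 < β)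
    (hn0 : 0 ≤ n) (hn2 : n ≤ 2) (lam : ℝ) {q : ℚ}
    (hbound : ∀ (ω : InfVolFermionState 2) (Ls : ℕ → ℕ), Tendsto Ls atTop atTop →
      ω.IsTorusLimitOfMixture (sectorGibbsCount n) (fun L => sectorGibbsWeightTT' β 1 tp U n L)
        (fun L => sectorGibbsVectorTT' 1 tp U n L) Ls →
      -((q : ℚ) : ℝ) ≤ (ω.expect (box 2 7) (-oddMomentObsTT tp U lam)).re) :
    ObsThermalStiffnessSeqCeilingAtBeta tp U n β q :=
  ObsThermalStiffnessSeqCeilingAtBeta_of_torusLimit_oddMoment_le hβ hn0 hn2 lam fun ω Ls hLs hω => by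
    have h := hbound ω Ls hLs hω
    rw [re_expect_neg_oddMomentObsTT] at h
    linarith

/-- **NEGATED ORBIT-MEAN reader shape ⇒ the leaf**: `−q ≤ |S|⁻¹ Σ_{γ∈S} Re ω_{γΛ₇}(Γ(d4Emb γ 0 Λ₇)(−X_λ))` on every torus
limit of the sector Gibbs states at `β` ⇒ `ObsThermalStiffnessSeqCeilingAtBeta t′ U n β q`. [cite: BratteliRobinsonI1987, §4.3.1]
[cite: Lipparini2008, eq. (8.30)] -/
theorem ObsThermalStiffnessSeqCeilingAtBeta_of_torusLimit_neg_oddMomentObs_orbitMean_ge {tp U n β : ℝ} (hβ : 0 < β)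
    (hn0 : 0 ≤ n) (hn2 : n ≤ 2) (lam : ℝ) {S : Finset (DihedralGroup 4)} (hS : S.Nonempty) {q : ℚ}
    (hbound : ∀ (ω : InfVolFermionState 2) (Ls : ℕ → ℕ), Tendsto Ls atTop atTop →
      ω.IsTorusLimitOfMixture (sectorGibbsCount n) (fun L => sectorGibbsWeightTT' β 1 tp U n L)
        (fun L => sectorGibbsVectorTT' 1 tp U n L) Ls →
      -((q : ℚ) : ℝ) ≤ (∑ γ ∈ S, (ω.expect (d4ShiftSet γ 0 (box 2 7))
        (fermionEmbed (PolySite.d4Emb γ 0 (box 2 7)) (-oddMomentObsTT tp U lam))).re) / S.card) :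
    ObsThermalStiffnessSeqCeilingAtBeta tp U n β q :=
  ObsThermalStiffnessSeqCeilingAtBeta_of_torusLimit_oddMoment_le hβ hn0 hn2 lam fun ω Ls hLs hω => by
    have hD : ω.IsD4Invariant := hω.isD4Invariant_of_sectorGibbs 1 tp U n β hLs
    have h := hbound ω Ls hLs hω
    simp_rw [hD.expect_fermionEmbed_d4Emb, re_expect_neg_oddMomentObsTT, Finset.sum_const, nsmul_eq_mul] at h
    have hc : (0 : ℝ) < S.card := Nat.cast_pos.2 (Finset.card_pos.2 hS)
    rw [mul_div_cancel_left₀ _ hc.ne'] at h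
    linarith

end Hook

/-! ## §3 `T_c` closures and the pre-registered row forms -/

namespace ThermalKTDictionaryAt

variable {tp U n : ℝ} {ρe : ℝ → ℝ} {Tc : ℝ}

/-- **ROUTE T-B′, orbit-mean kernel form: one certified orbit-mean odd-moment word at `β` + `(π/4)q < 1/β` ⇒ `Tc ≤ 1/β`.**
Keys K1t K1b K2 of the monotonicity-free `ThermalKTDictionaryAt`. [cite: HazraVermaRanderia2019, eqs. (2)–(4)]
[cite: BratteliRobinsonI1987, §4.3.1] -/
theorem le_inv_of_torusLimit_oddMoment_orbitMean_le (h : ThermalKTDictionaryAt tp U n ρe Tc) {β : ℝ} (hβ : 0 < β)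
    (hn0 : 0 ≤ n) (hn2 : n ≤ 2) (lam : ℝ) {S : Finset (DihedralGroup 4)} (hS : S.Nonempty) {q : ℚ}
    (hbound : ∀ (ω : InfVolFermionState 2) (Ls : ℕ → ℕ), Tendsto Ls atTop atTop →
      ω.IsTorusLimitOfMixture (sectorGibbsCount n) (fun L => sectorGibbsWeightTT' β 1 tp U n L)
        (fun L => sectorGibbsVectorTT' 1 tp U n L) Ls →
      (∑ γ ∈ S, rotOddMomentLimitFunctionalTT tp U lam γ ω) / S.card ≤ ((q : ℚ) : ℝ))
    (hlt : Real.pi / 4 * ((q : ℚ) : ℝ) < 1 / β) : Tc ≤ 1 / β :=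
  h.le_inv_of_leafAtBeta hβ
    (ObsThermalStiffnessSeqCeilingAtBeta_of_torusLimit_oddMoment_orbitMean_le hβ hn0 hn2 lam hS hbound) hlt

/-- **CALIBRATION row form at `(8, ⅞, 0)`, `β·t = 16/5`** (pre-registered, row-neutral: it re-certifies the cell's
`5/16` row of record by the independent Krylov-3 route): a single-temperature leaf `ObsThermalStiffnessSeqCeilingAtBeta 0 8 (7/8) (16/5) c`
with `c < 0.3978873` (`< 5/(4π)`) gives `Tc ≤ 5/16`. [cite: HazraVermaRanderia2019, eqs. (2)–(3)] -/
theorem le_five_sixteenths_of_leafAtBeta {ρe : ℝ → ℝ} {Tc : ℝ} (h : ThermalKTDictionaryAt 0 8 (7 / 8) ρe Tc) {c : ℚ}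
    (hleaf : ObsThermalStiffnessSeqCeilingAtBeta 0 8 (7 / 8) (16 / 5) c) (hc : ((c : ℚ) : ℝ) < 0.3978873) :
    Tc ≤ 5 / 16 := by
  have h' : Tc ≤ 1 / (16 / 5 : ℝ) := by
    refine h.le_inv_of_leafAtBeta (by norm_num) hleaf ?_
    have h1 : Real.pi * ((c : ℚ) : ℝ) < Real.pi * 0.3978873 := mul_lt_mul_of_pos_left hc Real.pi_pos
    have h2 : Real.pi * (0.3978873 : ℝ) < 3.141593 * 0.3978873 := mul_lt_mul_of_pos_right Real.pi_lt_d6 (by norm_num)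
    have h3 : (3.141593 : ℝ) * 0.3978873 < 5 / 4 := by norm_num
    have h4 : (1 : ℝ) / (16 / 5) = 5 / 16 := by norm_num
    rw [h4]; linarith
  simpa using h'

/-- **SECONDARY row form at `(8, ⅞, 0)`, `β·t = 9/2`** (pre-registered): a leaf `ObsThermalStiffnessSeqCeilingAtBeta 0 8 (7/8) (9/2) c`
with `c < 0.2829421` (`< 8/(9π)`) gives `Tc ≤ 2/9`. [cite: HazraVermaRanderia2019, eqs. (2)–(3)] -/
theorem le_two_ninths_of_leafAtBeta {ρe : ℝ → ℝ} {Tc : ℝ} (h : ThermalKTDictionaryAt 0 8 (7 / 8) ρe Tc) {c : ℚ}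
    (hleaf : ObsThermalStiffnessSeqCeilingAtBeta 0 8 (7 / 8) (9 / 2) c) (hc : ((c : ℚ) : ℝ) < 0.2829421) :
    Tc ≤ 2 / 9 := by
  have h' : Tc ≤ 1 / (9 / 2 : ℝ) := by
    refine h.le_inv_of_leafAtBeta (by norm_num) hleaf ?_
    have h1 : Real.pi * ((c : ℚ) : ℝ) < Real.pi * 0.2829421 := mul_lt_mul_of_pos_left hc Real.pi_pos
    have h2 : Real.pi * (0.2829421 : ℝ) < 3.14159265358979323847 * 0.2829421 :=
      mul_lt_mul_of_pos_right Real.pi_lt_d20 (by norm_num)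
    have h3 : (3.14159265358979323847 : ℝ) * 0.2829421 < 8 / 9 := by norm_num
    have h4 : (1 : ℝ) / (9 / 2) = 2 / 9 := by norm_num
    rw [h4]; linarith
  simpa using h'

/-- **PRIMARY row, orbit-mean shape, `(8, ⅞, 0)`, `β·t = 4`** («`T_KT ≤ t/4`», monotonicity-free, below the f-sum class):
an orbit-mean certificate `|S|⁻¹Σ_{γ∈S} rotOddMomentLimitFunctionalTT 0 8 λ γ ω ≤ q` on the torus limits of the canonical sector
Gibbs states at `β = 4` with `q < 0.3183098` gives `Tc ≤ 1/4`. [cite: HazraVermaRanderia2019, eqs. (2)–(4)] [cite: Lipparini2008, eq. (8.30)] -/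
theorem le_quarter_of_torusLimit_oddMoment_orbitMean_le_four (h : ThermalKTDictionaryAt 0 8 (7 / 8) ρe Tc) (lam : ℝ)
    {S : Finset (DihedralGroup 4)} (hS : S.Nonempty) {q : ℚ}
    (hbound : ∀ (ω : InfVolFermionState 2) (Ls : ℕ → ℕ), Tendsto Ls atTop atTop →
      ω.IsTorusLimitOfMixture (sectorGibbsCount (7 / 8)) (fun L => sectorGibbsWeightTT' 4 1 0 8 (7 / 8) L)
        (fun L => sectorGibbsVectorTT' 1 0 8 (7 / 8) L) Ls →
      (∑ γ ∈ S, rotOddMomentLimitFunctionalTT 0 8 lam γ ω) / S.card ≤ ((q : ℚ) : ℝ))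
    (hq : ((q : ℚ) : ℝ) < 0.3183098) : Tc ≤ 1 / 4 :=
  h.le_quarter_of_leafAtBeta_four
    (ObsThermalStiffnessSeqCeilingAtBeta_of_torusLimit_oddMoment_orbitMean_le (by norm_num) (by norm_num) (by norm_num)
      lam hS hbound) hq

/-- **CALIBRATION row, plain shape, `(8, ⅞, 0)`, `β·t = 16/5`**: `oddMomentLimitFunctionalTT 0 8 λ ω ≤ q` on the torus limits of
the canonical sector Gibbs states at `β = 16/5` with `q < 0.3978873` gives `Tc ≤ 5/16` (row-neutral re-certification of the
`5/16` row by the Krylov-3 route). [cite: HazraVermaRanderia2019, eqs. (2)–(4)] [cite: Lipparini2008, eq. (8.30)] -/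
theorem le_five_sixteenths_of_torusLimit_oddMoment_le (h : ThermalKTDictionaryAt 0 8 (7 / 8) ρe Tc) (lam : ℝ) {q : ℚ}
    (hbound : ∀ (ω : InfVolFermionState 2) (Ls : ℕ → ℕ), Tendsto Ls atTop atTop →
      ω.IsTorusLimitOfMixture (sectorGibbsCount (7 / 8)) (fun L => sectorGibbsWeightTT' (16 / 5) 1 0 8 (7 / 8) L)
        (fun L => sectorGibbsVectorTT' 1 0 8 (7 / 8) L) Ls →
      oddMomentLimitFunctionalTT 0 8 lam ω ≤ ((q : ℚ) : ℝ))
    (hq : ((q : ℚ) : ℝ) < 0.3978873) : Tc ≤ 5 / 16 :=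
  h.le_five_sixteenths_of_leafAtBeta
    (ObsThermalStiffnessSeqCeilingAtBeta_of_torusLimit_oddMoment_le (by norm_num) (by norm_num) (by norm_num) lam hbound) hq

/-- **CALIBRATION row, orbit-mean shape, `β·t = 16/5`** ⇒ `Tc ≤ 5/16` if `q < 0.3978873`. [cite: HazraVermaRanderia2019, eqs. (2)–(4)]
[cite: BratteliRobinsonI1987, §4.3.1] -/
theorem le_five_sixteenths_of_torusLimit_oddMoment_orbitMean_le (h : ThermalKTDictionaryAt 0 8 (7 / 8) ρe Tc) (lam : ℝ)
    {S : Finset (DihedralGroup 4)} (hS : S.Nonempty) {q : ℚ}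
    (hbound : ∀ (ω : InfVolFermionState 2) (Ls : ℕ → ℕ), Tendsto Ls atTop atTop →
      ω.IsTorusLimitOfMixture (sectorGibbsCount (7 / 8)) (fun L => sectorGibbsWeightTT' (16 / 5) 1 0 8 (7 / 8) L)
        (fun L => sectorGibbsVectorTT' 1 0 8 (7 / 8) L) Ls →
      (∑ γ ∈ S, rotOddMomentLimitFunctionalTT 0 8 lam γ ω) / S.card ≤ ((q : ℚ) : ℝ))
    (hq : ((q : ℚ) : ℝ) < 0.3978873) : Tc ≤ 5 / 16 :=
  h.le_five_sixteenths_of_leafAtBeta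
    (ObsThermalStiffnessSeqCeilingAtBeta_of_torusLimit_oddMoment_orbitMean_le (by norm_num) (by norm_num) (by norm_num)
      lam hS hbound) hq

/-- **SECONDARY row, plain shape, `(8, ⅞, 0)`, `β·t = 9/2`**: `oddMomentLimitFunctionalTT 0 8 λ ω ≤ q` on the torus limits of the
canonical sector Gibbs states at `β = 9/2` with `q < 0.2829421` gives `Tc ≤ 2/9`. [cite: HazraVermaRanderia2019, eqs. (2)–(4)]
[cite: Lipparini2008, eq. (8.30)] -/
theorem le_two_ninths_of_torusLimit_oddMoment_le (h : ThermalKTDictionaryAt 0 8 (7 / 8) ρe Tc) (lam : ℝ) {q : ℚ}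
    (hbound : ∀ (ω : InfVolFermionState 2) (Ls : ℕ → ℕ), Tendsto Ls atTop atTop →
      ω.IsTorusLimitOfMixture (sectorGibbsCount (7 / 8)) (fun L => sectorGibbsWeightTT' (9 / 2) 1 0 8 (7 / 8) L)
        (fun L => sectorGibbsVectorTT' 1 0 8 (7 / 8) L) Ls →
      oddMomentLimitFunctionalTT 0 8 lam ω ≤ ((q : ℚ) : ℝ))
    (hq : ((q : ℚ) : ℝ) < 0.2829421) : Tc ≤ 2 / 9 :=
  h.le_two_ninths_of_leafAtBeta
    (ObsThermalStiffnessSeqCeilingAtBeta_of_torusLimit_oddMoment_le (by norm_num) (by norm_num) (by norm_num) lam hbound) hq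

end ThermalKTDictionaryAt

end Summit.Ventures.CertifiedManyBodySolver.Observables
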